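import Literature.AlgebraicGeometry.ComplexMultiplication.CenterEndAlgebraTotallyRealOrCMOfRiemann
import Literature.AlgebraicGeometry.HodgeTheory.AbelianVarietyHodgeFullnessHolds
import Literature.AlgebraicTopology.SingularHomology.WuEulerCharacteristic
import Mathlib.RingTheory.Trace.Basic
import HarnessLib

/-!
# `[Z(End⁰ B) : ℚ]` divides `dim B` when the centre is totally real (Albert's Type I–III constraint `e ∣ g`)

D. Mumford, *Abelian Varieties* (1970), §21, the table after Theorem 2 (p. 202): for a simple abelian
variety `X` of dimension `g` with `D = End⁰(X)`, `K` the centre of `D`, `e = [K : ℚ]`, `d² = [D : K]`,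
`K₀` the subfield of `K` fixed by the Rosati involution, `e₀ = [K₀ : ℚ]`, the «restriction in char 0»
column reads: Type I (`D = K = K₀` totally real) `e ∣ g`; Type II, III (`K = K₀` totally real, `d = 2`)
`2e ∣ g`; Type IV (`K` a CM field, `e = 2e₀`) `e₀ d² ∣ g`.  Ch. Birkenhake, H. Lange, *Complex Abelian
Varieties*, Prop. 5.5.7, proves the same table from the rational representation: `H₁(X, ℚ)` is a vector
space over `D`, resp. over `K`, carrying the alternating Riemann form `E` with `E(ax, y) = E(x, a'y)`.

The tree already has the polarisation-free half `[D : ℚ] ∣ 2 dim B`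
(`ComplexMultiplication.finrank_endAlgebra_dvd_two_mul_dim`, file `EndAlgebraDegreeDvdTwoDim`), which IS
the Type IV row (`e₀ d² = [D:ℚ]/2`) and gives `2e ∣ g` in Types II/III once `d = 2` is known.  What the
alternating form adds is the row that is NOT a consequence of `[D:ℚ] ∣ 2g`:

**Type I–III: if the centre `K` of `End⁰(B)` is totally real then `[K : ℚ] ∣ dim B`.**

This file proves it for complex abelian varieties, on the tree's carriers, UNCONDITIONALLY: Riemann's
theorem `HodgeTheory.DeligneMilne1982_Thm_6_20_full` — the one record the sibling file
`CenterEndAlgebraTotallyRealOrCMOfRiemann` consumes as a hypothesis — is the tree theorem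
`deligneMilne1982_Thm_6_20_full_holds` (`HodgeTheory/AbelianVarietyHodgeFullnessHolds`); the sibling's adjoint
involution `ξ ↦ ξ'` of a polarisation `ψ` of `H¹(B(ℂ); ℚ)` replaces the Rosati involution of print:

* §1 `even_finrank_of_isAlt_of_smul_left_eq` — LINEAR ALGEBRA (the trace-form transfer): `K` a finite
  separable field extension of `ℚ`, `V` a finite-dimensional `K`-vector space, `ψ` a non-degenerate
  ALTERNATING `ℚ`-bilinear form on `V` which is `K`-BALANCED, `ψ(a x, y) = ψ(x, a y)`; then `dim_K V` is
  EVEN.  Proof: the trace form of `K/ℚ` is non-degenerate (`traceForm_nondegenerate`), so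
  `ψ(a x, y) = Tr_{K/ℚ}(a · t(x, y))` for a unique `t(x, y) ∈ K`; `t` is `K`-bilinear, alternating and
  non-degenerate, and a non-degenerate alternating form lives on an even-dimensional space
  (tree `SingularHomology.even_finrank_of_forall_apply_self_eq_zero`, Milnor–Husemoller I).
* §2 `finrank_dvd_dim_of_isAdjointPair_self` — for a number field `K → End⁰(B)` acting on `H¹(B(ℂ); ℚ)`
  by `ψ`-SELF-ADJOINT operators (`ψ(a^* x, y) = ψ(x, a^* y)`), `[K : ℚ] ∣ dim B`: `H¹` is a `K`-vector
  space of even dimension `2 dim B / [K:ℚ]` (§1 with `ψ` the alternating polarisation form of weight one,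
  tower law, `dim_ℚ H¹ = 2 dim B`).
* §3 `finrank_centerField_dvd_dim_of_isTotallyReal` — **the Type I–III row**: `B` simple of positive
  dimension, `K = CenterField B` (the centre of `End⁰(B)` as a number field) totally real ⟹
  `[K : ℚ] ∣ dim B`.  The adjoint involution preserves the centre (`exists_adjoint_center`) and is complex
  conjugation under every embedding (`apply_eq_conj_of_isAdjointPair'`), hence the IDENTITY on a totally
  real `K`: every `a ∈ K` acts self-adjointly, and §2 applies.  Restated on the subalgebra
  (`finrank_center_endAlgebra_dvd_dim_of_isTotallyReal`), and joined with the sibling dichotomy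
  (`center_isTotallyReal_or_isCMField_of_isSimple_of_riemann`) into
  `isTotallyReal_and_finrank_dvd_dim_or_isCMField`: the centre is totally real of degree dividing `dim B`,
  or a CM field.
* §4 `finrank_endAlgebra_dvd_dim_of_isField_of_isTotallyReal` — the COMMUTATIVE case without simplicity:
  if `End⁰(B)` is a totally real field then `[End⁰(B) : ℚ] ∣ dim B` (sibling `EndFieldTotallyRealOrCMOfRiemann`).

Not here (needs positivity of the involution on all of `D`, Mumford §21 Thm. 2): `d = 2` in Types II/III,
hence the sharper `2e ∣ g` there, and the Type IV signature conditions.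

## References
* [MumfordAV1970] D. Mumford, *Abelian Varieties* (1970), §20 (Rosati involution), §21 Thm. 2 and the
  table «restrictions in char 0» (p. 202); §19 Cor. 2 of Thm. 1.
* [LangeBirkenhake1992] Ch. Birkenhake, H. Lange, *Complex Abelian Varieties* (1992/2004), §5.5,
  Prop. 5.5.7 (the divisibilities `e ∣ g`, `2e ∣ g`, `e₀d² ∣ g` from the rational representation).
* [Shimura1998] G. Shimura, *Abelian Varieties with Complex Multiplication and Modular Functions* (1998),
  §5.1 Lemma 2, Propositions 2 and 5 (pp. 35–36).
* [DeligneMilne1982Tannakian] P. Deligne, J. S. Milne, *Tannakian Categories*, LNM 900 (1982), §6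
  Thm. 6.20 (Riemann) (record `HodgeTheory/AbelianVarietyHodgeFullnessRecord`).
* [MilnorHusemoller1973] J. Milnor, D. Husemoller, *Symmetric Bilinear Forms* (1973), Ch. I §3
  (alternating inner product spaces are hyperbolic, hence even-dimensional).
-/

noncomputable section

open Module NumberField

namespace Literature.AlgebraicGeometry.ComplexMultiplication

open Literature.AlgebraicGeometry.Motives Literature.AlgebraicGeometry.HodgeTheory
open Literature.AlgebraicGeometry.Motives.HodgeStructure

/-! ## §1 Linear algebra: a `K`-balanced non-degenerate alternating `ℚ`-form forces `dim_K V` even -/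

section TraceLift

variable {K : Type*} [Field K] [Algebra ℚ K] [FiniteDimensional ℚ K] [Algebra.IsSeparable ℚ K]
  {V : Type*} [AddCommGroup V] [Module ℚ V] [Module K V] [IsScalarTower ℚ K V] [FiniteDimensional ℚ V]

/-- **The trace-form transfer** (Birkenhake–Lange Prop. 5.5.7, proof; Mumford §21): let `K/ℚ` be a finite
separable field extension, `V` a finite-dimensional `K`-vector space and `ψ` a `ℚ`-bilinear form on `V`
which is ALTERNATING (`ψ(x, x) = 0`), LEFT NON-DEGENERATE, and `K`-BALANCED (`ψ(a x, y) = ψ(x, a y)` for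
all `a ∈ K`).  Then `dim_K V` is even: `ψ(a x, y) = Tr_{K/ℚ}(a · t(x, y))` defines a non-degenerate
alternating `K`-bilinear form `t` (non-degeneracy of the trace form, `traceForm_nondegenerate`), and
non-degenerate alternating forms live on even-dimensional spaces.
[cite: LangeBirkenhake1992, §5.5 Prop. 5.5.7 (proof)] [cite: MilnorHusemoller1973, Ch. I §3] -/
theorem even_finrank_of_isAlt_of_smul_left_eq (ψ : LinearMap.BilinForm ℚ V) (halt : ∀ x, ψ x x = 0)
    (hsep : ∀ x, (∀ y, ψ x y = 0) → x = 0) (hbal : ∀ (a : K) (x y : V), ψ (a • x) y = ψ x (a • y)) :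
    Even (Module.finrank K V) := by
  haveI : FiniteDimensional K V := Module.Finite.of_restrictScalars_finite ℚ K V
  -- skew-symmetry of `ψ`
  have hskew : ∀ u v, ψ u v = -ψ v u := fun u v => by
    have h := halt (u + v)
    simp only [map_add, LinearMap.add_apply, halt u, halt v, zero_add, add_zero] at h
    linarith
  -- the trace form of `K/ℚ` and its duality
  have hT : (Algebra.traceForm ℚ K).Nondegenerate := traceForm_nondegenerate ℚ K
  have hext : ∀ u v : K,
      (∀ a, Algebra.trace ℚ K (u * a) = Algebra.trace ℚ K (v * a)) → u = v := by
    intro u v h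
    refine sub_eq_zero.1 (hT.1 (u - v) fun a => ?_)
    rw [Algebra.traceForm_apply, sub_mul, map_sub, h a, sub_self]
  -- the functional `a ↦ ψ(a x, y)` and its trace representative `t(x, y)`
  let ℓ : V → V → Module.Dual ℚ K := fun x y =>
    { toFun := fun a => ψ (a • x) y
      map_add' := fun a b => by simp only [add_smul, map_add, LinearMap.add_apply]
      map_smul' := fun q a => by
        simp only [smul_assoc, map_smul, LinearMap.smul_apply, RingHom.id_apply] }
  let t : V → V → K := fun x y => ((Algebra.traceForm ℚ K).toDual hT).symm (ℓ x y)
  have ht : ∀ x y a, Algebra.trace ℚ K (t x y * a) = ψ (a • x) y := fun x y a => by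
    rw [← Algebra.traceForm_apply, LinearMap.BilinForm.apply_toDual_symm_apply]
    rfl
  -- `t` is `K`-bilinear
  have t_add_left : ∀ x₁ x₂ y, t (x₁ + x₂) y = t x₁ y + t x₂ y := fun x₁ x₂ y =>
    hext _ _ fun a => by rw [add_mul, map_add, ht, ht, ht, smul_add, map_add, LinearMap.add_apply]
  have t_smul_left : ∀ (c : K) x y, t (c • x) y = c • t x y := fun c x y =>
    hext _ _ fun a => by
      rw [ht, smul_smul, ← ht x y (a * c), smul_eq_mul]
      congr 1
      ring
  have t_add_right : ∀ x y₁ y₂, t x (y₁ + y₂) = t x y₁ + t x y₂ := fun x y₁ y₂ =>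
    hext _ _ fun a => by rw [add_mul, map_add, ht, ht, ht, map_add]
  have t_smul_right : ∀ (c : K) x y, t x (c • y) = c • t x y := fun c x y =>
    hext _ _ fun a => by
      rw [ht, ← hbal c, smul_smul, ← ht x y (c * a), smul_eq_mul]
      congr 1
      ring
  let tB : LinearMap.BilinForm K V := LinearMap.mk₂ K t t_add_left t_smul_left t_add_right t_smul_right
  have htB : ∀ x y, tB x y = t x y := fun _ _ => rfl
  -- `t` is alternating: `Tr(a · t(x, x)) = ψ(a x, x) = -ψ(x, a x) = -ψ(a x, x)`
  have t_alt : ∀ x, tB x x = 0 := fun x => by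
    rw [htB]
    refine hext _ _ fun a => ?_
    rw [zero_mul, map_zero, ht]
    have h := hskew (a • x) x
    rw [← hbal a x x] at h
    linarith
  -- `t` is non-degenerate: `ψ(x, y) = Tr(1 · t(x, y))`
  have t_sep : ∀ x, (∀ y, tB x y = 0) → x = 0 := fun x hx => hsep x fun y => by
    rw [← one_smul K x, ← ht, mul_one, ← htB, hx y, map_zero]
  exact Literature.AlgebraicTopology.SingularHomology.even_finrank_of_forall_apply_self_eq_zero
    (Module.finrank K V) tB t_alt t_sep rfl

end TraceLift

/-! ## §2 A number field of `ψ`-self-adjoint endomorphisms has degree dividing `dim B` -/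

variable {B : AbelianVariety ℂ}

/-- **`[K : ℚ] ∣ dim B` for a number field `K → End⁰(B)` acting self-adjointly on `H¹(B(ℂ); ℚ)`** for a
polarisation `ψ` of the weight-one Hodge structure (`ψ((φ a)^* x, y) = ψ(x, (φ a)^* y)` for all `a ∈ K` —
«the Rosati involution is trivial on `K`»): `H¹(B(ℂ); ℚ)`, of `ℚ`-dimension `2 dim B`
(`finrank_bettiCohomology_one`), is a `K`-vector space of EVEN dimension by the trace-form transfer
(`even_finrank_of_isAlt_of_smul_left_eq`: `ψ` is alternating in weight one and non-degenerate), and the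
tower law gives `[K:ℚ] · dim_K H¹ = 2 dim B`. [cite: LangeBirkenhake1992, §5.5 Prop. 5.5.7]
[cite: MumfordAV1970, §21 (table, p. 202)] -/
theorem finrank_dvd_dim_of_isAdjointPair_self (hHD : exists_isReal_hodgeModel)
    (ψ : Polarization (BettiUniverse.hodge hHD (AbelianVariety.isSmoothProjective_holds (A := B)) 1))
    {K : Type} [Field K] [NumberField K] (φ : K →+* B.endAlgebra)
    (hsa : ∀ a : K, LinearMap.IsAdjointPair ψ.form ψ.form (hOneAlgHom φ a) (hOneAlgHom φ a)) :
    Module.finrank ℚ K ∣ B.dim := by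
  haveI : FiniteDimensional ℚ (bettiCohomology B.X 1) := finite_bettiCohomology_one B
  letI : Module K (bettiCohomology B.X 1) := Module.compHom _ (hOneRingHom φ)
  have hsmul : ∀ (a : K) (x : bettiCohomology B.X 1), a • x = hOneAlgHom φ a x := fun a x => by
    change hOneRingHom φ a x = _
    rw [hOneAlgHom_apply, hOneRingHom_apply]
  haveI : IsScalarTower ℚ K (bettiCohomology B.X 1) := ⟨fun q a x => by
    rw [hsmul, hsmul, map_smul, LinearMap.smul_apply]⟩
  -- `ψ` is alternating (weight one), left non-degenerate and `K`-balanced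
  have halt : ∀ x, ψ.form x x = 0 := fun x => by
    have h := ψ.form_swap x x
    simp only [Nat.cast_one, Int.negOnePow_one, Units.val_neg, Units.val_one, Int.cast_neg, Int.cast_one,
      neg_one_mul] at h
    linarith
  have hbal : ∀ (a : K) (x y : bettiCohomology B.X 1), ψ.form (a • x) y = ψ.form x (a • y) :=
    fun a x y => by rw [hsmul, hsmul]; exact hsa a x y
  have heven := even_finrank_of_isAlt_of_smul_left_eq (K := K) ψ.form halt ψ.nondegenerate.1 hbal
  -- tower law
  have htower := Module.finrank_mul_finrank ℚ K (bettiCohomology B.X 1)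
  rw [finrank_bettiCohomology_one] at htower
  obtain ⟨m, hm⟩ := heven
  refine ⟨m, ?_⟩
  have h2 : 2 * B.dim = 2 * (Module.finrank ℚ K * m) := by rw [← htower, hm]; ring
  exact Nat.eq_of_mul_eq_mul_left two_pos h2

/-! ## §3 Albert's Type I–III constraint: a totally real centre has degree dividing `dim B` -/

/-- **Mumford §21 / Albert, Types I–III: `[K : ℚ] ∣ dim B` for the totally real centre `K` of `End⁰(B)`,
`B` simple** (complex, of positive dimension; from Riemann's theorem).  The adjoint involution `a ↦ a'`
of a polarisation `ψ` of `H¹(B(ℂ); ℚ)` maps the centre to itself (`exists_adjoint_center`) with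
`σ(a') = conj σ(a)` for every embedding `σ : K → ℂ` (`apply_eq_conj_of_isAdjointPair'`); all embeddings of
a totally real field are real, so `a' = a`: the centre acts by `ψ`-self-adjoint operators and
`finrank_dvd_dim_of_isAdjointPair_self` applies.  (Print: «Type I … `e | g`», «Type II, III … `2e | g`»;
the extra factor `2` in Types II/III needs `d = 2`, not proved here.)
[cite: MumfordAV1970, §21 Thm. 2 and table (p. 202)] [cite: LangeBirkenhake1992, §5.5 Prop. 5.5.7]
[cite: Shimura1998, §5.1 Lemma 2, Proposition 5 (pp. 35–36)] [cite: DeligneMilne1982Tannakian, §6 Thm. 6.20 (Riemann)] -/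
theorem finrank_centerField_dvd_dim_of_isTotallyReal
    (hB : AbelianVariety.IsSimple B) (hB0 : 0 < B.dim) (hK : IsTotallyReal (CenterField B hB hB0)) :
    Module.finrank ℚ (CenterField B hB hB0) ∣ B.dim := by
  have hR : DeligneMilne1982_Thm_6_20_full := deligneMilne1982_Thm_6_20_full_holds
  have hHD : exists_isReal_hodgeModel := exists_isReal_hodgeModel_holds
  have hI : hodgePQ_independent_of_hodgeModel := hodgePQ_independent_of_hodgeModel_holds
  have hXB : IsSmoothProjective B.dim B.X := AbelianVariety.isSmoothProjective_holds
  obtain ⟨ψ⟩ : (BettiUniverse.hodge hHD hXB 1).IsPolarizable :=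
    smoothProjective_hodgeStructure_isPolarizable_holds hXB (BettiUniverse.realHodgeModel hHD hXB)
      (BettiUniverse.realHodgeModel_isHodgeSymmetric hHD hXB) 1
  let φ : CenterField B hB hB0 →+* B.endAlgebra := CenterField.val hB hB0
  refine finrank_dvd_dim_of_isAdjointPair_self hHD ψ φ fun a => ?_
  -- the adjoint `a'` of `a` inside the centre
  obtain ⟨ζ', hζ', h⟩ := exists_adjoint_center hHD hI hR ψ
    (show Subalgebra.center ℚ B.endAlgebra from a).2
  let a' : CenterField B hB hB0 := (show CenterField B hB hB0 from ⟨ζ', hζ'⟩)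
  have h' : LinearMap.IsAdjointPair ψ.form ψ.form (hOneAlgHom φ a) (hOneAlgHom φ a') := by
    rw [hOneAlgHom_apply, hOneAlgHom_apply]; exact h
  -- `σ(a') = conj σ(a) = σ(a)` for a (real) embedding `σ`, hence `a' = a`
  obtain ⟨σ⟩ : Nonempty (CenterField B hB hB0 →+* ℂ) := inferInstance
  have hσ : ComplexEmbedding.IsReal σ := InfinitePlace.isReal_mk_iff.1 (hK.isReal (InfinitePlace.mk σ))
  have hconj : σ a' = σ a := by
    rw [apply_eq_conj_of_isAdjointPair' hHD hI hB0 ψ φ h' σ, ← ComplexEmbedding.conjugate_coe_eq,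
      ComplexEmbedding.isReal_iff.1 hσ]
  have haa : a' = a := σ.injective hconj
  rw [haa] at h'
  exact h'

/-- The same on the subalgebra `Z(End⁰ B) = Subalgebra.center ℚ End⁰(B)` (its `ℚ`-dimension is that of
`CenterField B`, the same underlying type). [cite: MumfordAV1970, §21 (table, p. 202)] -/
theorem finrank_center_endAlgebra_dvd_dim_of_isTotallyReal
    (hB : AbelianVariety.IsSimple B) (hB0 : 0 < B.dim) (hK : IsTotallyReal (CenterField B hB hB0)) :
    Module.finrank ℚ (Subalgebra.center ℚ B.endAlgebra) ∣ B.dim := by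
  have h := finrank_centerField_dvd_dim_of_isTotallyReal hB hB0 hK
  have e : Module.finrank ℚ (CenterField B hB hB0) =
      Module.finrank ℚ (Subalgebra.center ℚ B.endAlgebra) :=
    (ratModule_transfer (M := Subalgebra.center ℚ B.endAlgebra) _ _).1
  rwa [e] at h

/-- **Albert's dichotomy for the centre, with the Type I–III divisibility** (unconditional form for
complex abelian varieties): for `B` simple of positive dimension, the centre `K` of `End⁰(B)` is EITHER
totally real with `[K : ℚ] ∣ dim B`, OR a CM field (Shimura §5.1 Prop. 5 = the tree's
`center_isTotallyReal_or_isCMField_of_isSimple_of_riemann`, Riemann's theorem being the tree theorem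
`deligneMilne1982_Thm_6_20_full_holds`).  With `[End⁰(B) : ℚ] ∣ 2 dim B`
(`finrank_endAlgebra_dvd_two_mul_dim`) this is the divisibility content of Mumford's table in char `0`
short of `d = 2` for Types II/III. [cite: MumfordAV1970, §21 Thm. 2 and table (p. 202)]
[cite: Shimura1998, §5.1 Proposition 5 (p. 36)] -/
theorem isTotallyReal_and_finrank_dvd_dim_or_isCMField (hB : AbelianVariety.IsSimple B) (hB0 : 0 < B.dim) :
    (IsTotallyReal (CenterField B hB hB0) ∧ Module.finrank ℚ (CenterField B hB hB0) ∣ B.dim) ∨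
      IsCMField (CenterField B hB hB0) := by
  rcases center_isTotallyReal_or_isCMField_of_isSimple_of_riemann deligneMilne1982_Thm_6_20_full_holds
      hB hB0 with h | h
  · exact Or.inl ⟨h, finrank_centerField_dvd_dim_of_isTotallyReal hB hB0 h⟩
  · exact Or.inr h

/-! ## §4 The commutative case: a totally real endomorphism FIELD has degree dividing `dim B` -/

/-- **If `End⁰(B)` is a totally real FIELD then `[End⁰(B) : ℚ] ∣ dim B`** (complex `B` of positive
dimension, NOT assumed simple — e.g. real multiplication by a totally real field exhausting `End⁰`):
the adjoint involution of a polarisation of `H¹(B(ℂ); ℚ)` on `K = End⁰(B)` (sibling file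
`EndFieldTotallyRealOrCMOfRiemann`: `exists_adjoint`, `apply_eq_conj_of_isAdjointPair`) is complex
conjugation under every embedding, hence trivial on a totally real `K`, and
`finrank_dvd_dim_of_isAdjointPair_self` applies.  (Mumford §21, Type I: `End⁰(X) = K` totally real,
`e ∣ g`.) [cite: MumfordAV1970, §21 (table, p. 202)] [cite: LangeBirkenhake1992, §5.5 Prop. 5.5.7]
[cite: Shimura1998, §5.1 Lemma 2 (p. 35)] -/
theorem finrank_endAlgebra_dvd_dim_of_isField_of_isTotallyReal (hF : IsField B.endAlgebra)
    (hB0 : 0 < B.dim) (hK : IsTotallyReal (EndField B hF)) :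
    Module.finrank ℚ B.endAlgebra ∣ B.dim := by
  have hR : DeligneMilne1982_Thm_6_20_full := deligneMilne1982_Thm_6_20_full_holds
  have hHD : exists_isReal_hodgeModel := exists_isReal_hodgeModel_holds
  have hI : hodgePQ_independent_of_hodgeModel := hodgePQ_independent_of_hodgeModel_holds
  have hXB : IsSmoothProjective B.dim B.X := AbelianVariety.isSmoothProjective_holds
  obtain ⟨ψ⟩ : (BettiUniverse.hodge hHD hXB 1).IsPolarizable :=
    smoothProjective_hodgeStructure_isPolarizable_holds hXB (BettiUniverse.realHodgeModel hHD hXB)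
      (BettiUniverse.realHodgeModel_isHodgeSymmetric hHD hXB) 1
  rw [← EndField.finrank_eq hF]
  refine finrank_dvd_dim_of_isAdjointPair_self hHD ψ (EndField.toEndAlgebra hF).toRingHom fun a => ?_
  obtain ⟨a', h'⟩ := exists_adjoint hF hHD hI hR ψ a
  obtain ⟨σ⟩ : Nonempty (EndField B hF →+* ℂ) := inferInstance
  have hσ : ComplexEmbedding.IsReal σ := InfinitePlace.isReal_mk_iff.1 (hK.isReal (InfinitePlace.mk σ))
  have hconj : σ a' = σ a := by
    rw [apply_eq_conj_of_isAdjointPair hF hHD hI hB0 ψ h' σ, ← ComplexEmbedding.conjugate_coe_eq,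
      ComplexEmbedding.isReal_iff.1 hσ]
  have haa : a' = a := σ.injective hconj
  rw [haa] at h'
  exact h'

/-! ## §5 Albert's `e₀ ∣ g` in all four types: the maximal real subfield of the centre

(Appended.)  Mumford §21's table lists `e ∣ g` (Type I), `2e ∣ g` (Types II, III), `e₀ d² ∣ g` (Type IV);
in every row the degree `e₀ = [K₀ : ℚ]` of the maximal totally real subfield `K₀` of the centre `K` — the
number of archimedean places of `K` — divides `g`.  Types I–III: `K = K₀` and §3.  Type IV: `K` is CM,
`[K : ℚ] = 2 e₀`, and `[K : ℚ] ∣ 2 dim B` because `H¹(B(ℂ); ℚ)` is a `K`-vector space — so `2 e₀ ∣ 2 g`. -/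

/-- **Any number field `K → End⁰(B)` has `[K : ℚ] ∣ 2 dim B`**: `H¹(B(ℂ); ℚ)`, of dimension `2 dim B`,
is a `K`-vector space through the rational representation (tower law).  (Shimura §5.1 Prop. 2:
`tr(ξ) = m · Tr_{K/ℚ}(ξ)`, i.e. `H¹` is free over `K`.) [cite: Shimura1998, §5.1 Proposition 2 (p. 36)]
[cite: MumfordAV1970, §19 Cor. 2 of Thm. 1] -/
theorem finrank_dvd_two_mul_dim_of_ringHom {K : Type} [Field K] [NumberField K] (φ : K →+* B.endAlgebra) :
    Module.finrank ℚ K ∣ 2 * B.dim := by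
  haveI : FiniteDimensional ℚ (bettiCohomology B.X 1) := finite_bettiCohomology_one B
  letI : Module K (bettiCohomology B.X 1) := Module.compHom _ (hOneRingHom φ)
  have hsmul : ∀ (a : K) (x : bettiCohomology B.X 1), a • x = hOneAlgHom φ a x := fun a x => by
    change hOneRingHom φ a x = _
    rw [hOneAlgHom_apply, hOneRingHom_apply]
  haveI : IsScalarTower ℚ K (bettiCohomology B.X 1) := ⟨fun q a x => by
    rw [hsmul, hsmul, map_smul, LinearMap.smul_apply]⟩
  have htower := Module.finrank_mul_finrank ℚ K (bettiCohomology B.X 1)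
  rw [finrank_bettiCohomology_one] at htower
  exact Dvd.intro _ htower

/-- **Albert's `e₀ ∣ g` for every simple complex abelian variety** (Mumford §21 table, all four types
at once), in the uniform form «the number of archimedean places of the centre `K` of `End⁰(B)` divides
`dim B`»: that number is `e₀ = [K₀ : ℚ]`, `K₀` the maximal totally real subfield (`= [K:ℚ]` real places
if `K` is totally real, `= [K:ℚ]/2` complex places if `K` is CM).  Types I–III:
`finrank_centerField_dvd_dim_of_isTotallyReal` with `IsTotallyReal.finrank`; Type IV: `[K : ℚ] ∣ 2 dim B`
(`finrank_dvd_two_mul_dim_of_ringHom`) with `IsTotallyComplex.finrank` (`[K:ℚ] = 2 ·` complex places).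
The dichotomy is `isTotallyReal_and_finrank_dvd_dim_or_isCMField`.
[cite: MumfordAV1970, §21 Thm. 2 and table (p. 202)] [cite: LangeBirkenhake1992, §5.5 Prop. 5.5.7] -/
theorem card_infinitePlace_centerField_dvd_dim (hB : AbelianVariety.IsSimple B) (hB0 : 0 < B.dim) :
    Fintype.card (InfinitePlace (CenterField B hB hB0)) ∣ B.dim := by
  rw [InfinitePlace.card_eq_nrRealPlaces_add_nrComplexPlaces]
  rcases isTotallyReal_and_finrank_dvd_dim_or_isCMField hB hB0 with ⟨hTR, hdvd⟩ | hCM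
  · haveI := hTR
    rwa [IsTotallyReal.nrComplexPlaces_eq_zero, add_zero, ← IsTotallyReal.finrank]
  · haveI := hCM
    have he : Module.finrank ℚ (CenterField B hB hB0) ∣ 2 * B.dim :=
      finrank_dvd_two_mul_dim_of_ringHom (CenterField.val hB hB0)
    rw [IsTotallyComplex.finrank] at he
    rw [IsTotallyComplex.nrRealPlaces_eq_zero, zero_add]
    exact Nat.dvd_of_mul_dvd_mul_left two_pos he

end Literature.AlgebraicGeometry.ComplexMultiplication

end
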